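import Summits.Ventures.Crystal3D.Theorems.StickyWulffConstantCoaxialWallLawIncoherentCountGrain
import Summits.Ventures.Crystal3D.Theorems.StickyWulffConstantCoaxialWallLawPayerTransCellPlaneTop
import HarnessLib

/-!
# Incoherent translation pairs, rigid fillings II″: the TWO-GRAIN deficit count `4φ₁·πρ²`

HONEST FRAMING. Venture `Summits/Ventures/Crystal3D` (cell `crystal3d-full`), helper `--supports` the crux
`CoaxialWallLaw` (stmt-Ventures-19481, line `WallLedgerF`, stub `stub_coaxialTwoSlabAdhesion`).  Rung credit only; F-C1
not moved.  F-MED (ii) (cf-p1 g28 16:48:23Z — the first task of the (F-thin-comm) census-free road), 19481-p2 g6: for an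
INCOHERENT translation pair (same frame `A`, the grains never touch) with a RIGID filling, the window's missing contacts
pay BOTH grains' free surfaces: the bottom grain's rising line tops (`translate_deficit_ge_incoherent_rigid_grain`, located
at `Λ₁`-balls) and, in the vertically mirrored cell, the top grain's falling line bottoms (located at `Λ₂`-balls); the two
ball sets are disjoint, so the counts ADD:
`Σ_{z ∈ X, −R₀−2 ≤ z₂ ≤ h+R₀+2} (12 − deg z) ≥ 4φ₁·πρ² − 24(12√2π + 36R₀ + 144)ρ` (`φ₂ = φ₁` for a translation pair).
* `translate_deficit_ge_incoherent_rigid_twoGrain`.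
WHAT THIS IS NOT: arbitrary fillings (the filler ledger of `…IncoherentBonded` then adds `Σ_f g(f)` verbatim — next file);
the stub; F-C1 not moved.
-/

noncomputable section

namespace Summit.Ventures.Crystal3D.Theorems

open Summit.Ventures.Crystal3D Finset
open Literature.MathematicalPhysics.StatisticalMechanics (fccStacking)
open scoped InnerProductSpace

open scoped Classical in
/-- **The two-grain deficit count for an incoherent translation pair with a rigid filling.**  See the module docstring. -/
theorem translate_deficit_ge_incoherent_rigid_twoGrain
    (A : EuclideanSpace ℝ (Fin 3) ≃ₗᵢ[ℝ] EuclideanSpace ℝ (Fin 3)) (t₁ t₂ : EuclideanSpace ℝ (Fin 3))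
    (hA : ∀ q ∈ fccStacking 1 (Real.sqrt (2 / 3)), ‖q + A.symm (t₂ - t₁)‖ ≠ 1)
    (X P₁ P₂ : Finset (EuclideanSpace ℝ (Fin 3))) (R₀ h ρ : ℝ)
    (hR₀ : 10 ≤ R₀) (hh : 0 ≤ h) (hρ : R₀ ≤ ρ)
    (hX : ∀ p ∈ X, ∀ q ∈ X, p ≠ q → 1 ≤ dist p q)
    (hcell : ∀ p ∈ X, -(2 * R₀) ≤ p 2 ∧ p 2 ≤ h + 2 * R₀ ∧ p 0 ^ 2 + p 1 ^ 2 ≤ ρ ^ 2)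
    (hP₁X : P₁ ⊆ X) (hP₂X : P₂ ⊆ X)
    (hP₁ : ∀ p, p ∈ P₁ ↔ (p ∈ (fun q => A q + t₁) '' fccStacking 1 (Real.sqrt (2 / 3)) ∧
      -(2 * R₀) ≤ p 2 ∧ p 2 ≤ -R₀ ∧ p 0 ^ 2 + p 1 ^ 2 ≤ ρ ^ 2))
    (hP₂ : ∀ p, p ∈ P₂ ↔ (p ∈ (fun q => A q + t₂) '' fccStacking 1 (Real.sqrt (2 / 3)) ∧
      h + R₀ ≤ p 2 ∧ p 2 ≤ h + 2 * R₀ ∧ p 0 ^ 2 + p 1 ^ 2 ≤ ρ ^ 2))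
    (hrig : ∀ x ∈ X, x ∈ (fun q => A q + t₁) '' fccStacking 1 (Real.sqrt (2 / 3)) ∨
      x ∈ (fun q => A q + t₂) '' fccStacking 1 (Real.sqrt (2 / 3))) :
    2 * (2 * (Real.sqrt 2 / 4 * ∑ᶠ w ∈ {w ∈ fccStacking 1 (Real.sqrt (2 / 3)) | ‖w‖ = 1},
        |⟪w, A.symm (EuclideanSpace.single (2 : Fin 3) (1 : ℝ))⟫_ℝ|) * Real.pi * ρ ^ 2) -
        24 * (12 * Real.sqrt 2 * Real.pi + 36 * R₀ + 144) * ρ ≤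
      ∑ z ∈ X.filter (fun z => -R₀ - 2 ≤ z 2 ∧ z 2 ≤ h + R₀ + 2),
        ((12 : ℝ) - ((X.filter fun q => dist z q = 1).card : ℝ)) := by
  set Λ₁ := (fun q => A q + t₁) '' fccStacking 1 (Real.sqrt (2 / 3)) with hΛ₁
  set Λ₂ := (fun q => A q + t₂) '' fccStacking 1 (Real.sqrt (2 / 3)) with hΛ₂
  -- (1) the bottom grain
  have h₁ := translate_deficit_ge_incoherent_rigid_grain A t₁ t₂ hA X P₁ P₂ R₀ h ρ hR₀ hh hρ hX hcell hP₁X hP₂X hP₁ hP₂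
    hrig
  -- the vertical mirror `S` and the cell mirror `M`
  set S : EuclideanSpace ℝ (Fin 3) ≃ₗᵢ[ℝ] EuclideanSpace ℝ (Fin 3) :=
    ((ℝ ∙ EuclideanSpace.single (2 : Fin 3) (1 : ℝ)).reflection).trans (LinearIsometryEquiv.neg ℝ) with hS
  have hS_apply : ∀ p, S p = -((ℝ ∙ EuclideanSpace.single (2 : Fin 3) (1 : ℝ)).reflection p) := fun p => rfl
  have hS0 : ∀ p : EuclideanSpace ℝ (Fin 3), S p 0 = p 0 := by
    intro p; rw [hS_apply, PiLp.neg_apply, (halfTurn_coord p).1, neg_neg]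
  have hS1 : ∀ p : EuclideanSpace ℝ (Fin 3), S p 1 = p 1 := by
    intro p; rw [hS_apply, PiLp.neg_apply, (halfTurn_coord p).2.1, neg_neg]
  have hS2 : ∀ p : EuclideanSpace ℝ (Fin 3), S p 2 = -p 2 := by
    intro p; rw [hS_apply, PiLp.neg_apply, (halfTurn_coord p).2.2]
  have hSS : ∀ p, S (S p) = p := by
    intro p
    ext l
    fin_cases l
    · simp only [Fin.zero_eta, Fin.isValue]; rw [hS0, hS0]
    · simp only [Fin.mk_one, Fin.isValue]; rw [hS1, hS1]
    · simp only [Fin.reduceFinMk, Fin.isValue]; rw [hS2, hS2, neg_neg]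
  clear_value S
  have hSin : ∀ x y : EuclideanSpace ℝ (Fin 3), ⟪S x, y⟫_ℝ = ⟪x, S y⟫_ℝ := by
    intro x y; rw [← S.inner_map_map x (S y), hSS]
  set cM : EuclideanSpace ℝ (Fin 3) := h • EuclideanSpace.single (2 : Fin 3) (1 : ℝ) with hcM
  have hc0 : cM 0 = 0 := by simp [hcM]
  have hc1 : cM 1 = 0 := by simp [hcM]
  have hc2 : cM 2 = h := by simp [hcM]
  let M : EuclideanSpace ℝ (Fin 3) → EuclideanSpace ℝ (Fin 3) := fun p => S p + cM
  have hM0 : ∀ p, M p 0 = p 0 := by intro p; simp only [M, PiLp.add_apply, hS0, hc0, add_zero]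
  have hM1 : ∀ p, M p 1 = p 1 := by intro p; simp only [M, PiLp.add_apply, hS1, hc1, add_zero]
  have hM2 : ∀ p, M p 2 = h - p 2 := by
    intro p; simp only [M, PiLp.add_apply, hS2, hc2]; ring
  have hSc : S cM = -cM := by
    ext l; fin_cases l
    · simp only [Fin.zero_eta, Fin.isValue]; rw [hS0, PiLp.neg_apply, hc0, neg_zero]
    · simp only [Fin.mk_one, Fin.isValue]; rw [hS1, PiLp.neg_apply, hc1, neg_zero]
    · simp only [Fin.reduceFinMk, Fin.isValue]; rw [hS2, PiLp.neg_apply]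
  have hMM : ∀ p, M (M p) = p := by
    intro p
    simp only [M, map_add, hSS, hSc]; abel
  have hMinj : Function.Injective M := fun p q hpq => by
    have := congrArg M hpq; rwa [hMM, hMM] at this
  have hMdist : ∀ p q, dist (M p) (M q) = dist p q := by
    intro p q; simp only [M, dist_add_right, LinearIsometryEquiv.dist_map]
  have hMadd : ∀ p w, M (p + w) = M p + S w := by
    intro p w; simp only [M, map_add]; abel
  have hMsub' : ∀ p w, M (p - w) = M p - S w := by
    intro p w; simp only [M, map_sub]; abel
  have hMsubM : ∀ p q, M p - M q = S (p - q) := by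
    intro p q; simp only [M, map_sub]; abel
  have hMrad : ∀ p, M p 0 ^ 2 + M p 1 ^ 2 = p 0 ^ 2 + p 1 ^ 2 := by intro p; rw [hM0, hM1]
  -- the mirrored data
  set X' := X.image M with hX'
  have hmemIm : ∀ (Q : Finset (EuclideanSpace ℝ (Fin 3))) p, p ∈ Q.image M ↔ M p ∈ Q := by
    intro Q p
    rw [mem_image]
    constructor
    · rintro ⟨x, hx, hxp⟩; rw [← hxp, hMM]; exact hx
    · intro hp; exact ⟨M p, hp, hMM p⟩
  have hmemX' : ∀ p, p ∈ X' ↔ M p ∈ X := hmemIm X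
  have hX'sep : ∀ p ∈ X', ∀ q ∈ X', p ≠ q → 1 ≤ dist p q := by
    intro p hp q hq hpq
    rw [← hMdist]
    exact hX _ ((hmemX' p).1 hp) _ ((hmemX' q).1 hq) (fun h' => hpq (hMinj h'))
  have hcell' : ∀ p ∈ X', -(2 * R₀) ≤ p 2 ∧ p 2 ≤ h + 2 * R₀ ∧ p 0 ^ 2 + p 1 ^ 2 ≤ ρ ^ 2 := by
    intro p hp
    obtain ⟨h1, h2, h3⟩ := hcell _ ((hmemX' p).1 hp)
    rw [hM2] at h1 h2; rw [hMrad] at h3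
    exact ⟨by linarith, by linarith, h3⟩
  set G' : EuclideanSpace ℝ (Fin 3) ≃ₗᵢ[ℝ] EuclideanSpace ℝ (Fin 3) := A.trans S with hG'
  have hG'ap : ∀ x, G' x = S (A x) := fun x => rfl
  clear_value G'
  have hG'symm : ∀ x, G'.symm x = A.symm (S x) := by
    intro x
    apply G'.injective
    rw [LinearIsometryEquiv.apply_symm_apply, hG'ap, LinearIsometryEquiv.apply_symm_apply, hSS]
  have hlat : ∀ (s p : EuclideanSpace ℝ (Fin 3)),
      M p ∈ (fun q => A q + s) '' fccStacking 1 (Real.sqrt (2 / 3)) ↔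
        p ∈ (fun q => G' q + M s) '' fccStacking 1 (Real.sqrt (2 / 3)) := by
    intro s p
    simp only [Set.mem_image, hG'ap]
    constructor
    · rintro ⟨q, hq, hqp⟩
      refine ⟨q, hq, ?_⟩
      have hqp' : s + A q = M p := by rw [add_comm]; exact hqp
      have := congrArg M hqp'
      rw [hMM, hMadd] at this
      rw [add_comm]; exact this
    · rintro ⟨q, hq, hqp⟩
      refine ⟨q, hq, ?_⟩
      rw [← hqp, show S (A q) + M s = M (s + A q) by rw [hMadd, add_comm], hMM, add_comm]
  have hP₁' : ∀ p, p ∈ P₂.image M ↔ (p ∈ (fun q => G' q + M t₂) '' fccStacking 1 (Real.sqrt (2 / 3)) ∧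
      -(2 * R₀) ≤ p 2 ∧ p 2 ≤ -R₀ ∧ p 0 ^ 2 + p 1 ^ 2 ≤ ρ ^ 2) := by
    intro p
    rw [hmemIm, hP₂, hM2, hMrad, hlat]
    constructor
    · rintro ⟨h1, h2, h3, h4⟩; exact ⟨h1, by linarith, by linarith, h4⟩
    · rintro ⟨h1, h2, h3, h4⟩; exact ⟨h1, by linarith, by linarith, h4⟩
  have hP₂' : ∀ p, p ∈ P₁.image M ↔ (p ∈ (fun q => G' q + M t₁) '' fccStacking 1 (Real.sqrt (2 / 3)) ∧
      h + R₀ ≤ p 2 ∧ p 2 ≤ h + 2 * R₀ ∧ p 0 ^ 2 + p 1 ^ 2 ≤ ρ ^ 2) := by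
    intro p
    rw [hmemIm, hP₁, hM2, hMrad, hlat]
    constructor
    · rintro ⟨h1, h2, h3, h4⟩; exact ⟨h1, by linarith, by linarith, h4⟩
    · rintro ⟨h1, h2, h3, h4⟩; exact ⟨h1, by linarith, by linarith, h4⟩
  have hP₁'X : P₂.image M ⊆ X' := image_subset_image hP₂X
  have hP₂'X : P₁.image M ⊆ X' := image_subset_image hP₁X
  -- (2) the top grain, in the mirrored cell
  have hA' : ∀ q ∈ fccStacking 1 (Real.sqrt (2 / 3)), ‖q + G'.symm (M t₁ - M t₂)‖ ≠ 1 := by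
    intro q hq
    have e : G'.symm (M t₁ - M t₂) = -A.symm (t₂ - t₁) := by
      rw [hMsubM, hG'symm, hSS, ← map_neg, neg_sub]
    rw [e, ← sub_eq_add_neg, ← norm_neg, neg_sub, sub_eq_neg_add]
    exact hA (-q) (fcc_neg_mem hq)
  have hrig' : ∀ x ∈ X', x ∈ (fun q => G' q + M t₂) '' fccStacking 1 (Real.sqrt (2 / 3)) ∨
      x ∈ (fun q => G' q + M t₁) '' fccStacking 1 (Real.sqrt (2 / 3)) := by
    intro x hx
    rcases hrig _ ((hmemX' x).1 hx) with h1 | h2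
    · exact Or.inr ((hlat t₁ x).1 h1)
    · exact Or.inl ((hlat t₂ x).1 h2)
  have h₂ := translate_deficit_ge_incoherent_rigid_grain G' (M t₂) (M t₁) hA' X' (P₂.image M) (P₁.image M) R₀ h ρ
    hR₀ hh hρ hX'sep hcell' hP₁'X hP₂'X hP₁' hP₂' hrig'
  -- the mirrored flux is the same flux
  have hflux : (Real.sqrt 2 / 4 * ∑ᶠ w ∈ {w ∈ fccStacking 1 (Real.sqrt (2 / 3)) | ‖w‖ = 1},
      |⟪w, G'.symm (EuclideanSpace.single (2 : Fin 3) (1 : ℝ))⟫_ℝ|) =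
      Real.sqrt 2 / 4 * ∑ᶠ w ∈ {w ∈ fccStacking 1 (Real.sqrt (2 / 3)) | ‖w‖ = 1},
        |⟪w, A.symm (EuclideanSpace.single (2 : Fin 3) (1 : ℝ))⟫_ℝ| := by
    have hSe : S (EuclideanSpace.single (2 : Fin 3) (1 : ℝ)) = -EuclideanSpace.single (2 : Fin 3) (1 : ℝ) := by
      ext l
      fin_cases l
      · simp only [Fin.zero_eta, Fin.isValue]; rw [hS0, PiLp.neg_apply]; simp
      · simp only [Fin.mk_one, Fin.isValue]; rw [hS1, PiLp.neg_apply]; simp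
      · simp only [Fin.reduceFinMk, Fin.isValue]; rw [hS2, PiLp.neg_apply]
    rw [hG'symm, hSe, map_neg]
    congr 1
    refine finsum_congr fun w => ?_
    rw [inner_neg_right, abs_neg]
  rw [hflux] at h₂
  -- the mirrored window sum, pulled back: the window is symmetric and `M z ∈ Λ₁' ↔ z ∈ Λ₂`
  have hdeg : ∀ b, (X'.filter fun q => dist b q = 1).card = (X.filter fun q => dist (M b) q = 1).card := by
    intro b
    have : (X.filter fun q => dist (M b) q = 1) = (X'.filter fun q => dist b q = 1).image M := by
      ext q
      rw [mem_filter, mem_image]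
      constructor
      · rintro ⟨hq, hd⟩
        refine ⟨M q, mem_filter.2 ⟨(hmemX' _).2 (by rw [hMM]; exact hq), ?_⟩, hMM q⟩
        rw [← hMdist, hMM]; exact hd
      · rintro ⟨q', hq', rfl⟩
        obtain ⟨hq'X, hd⟩ := mem_filter.1 hq'
        exact ⟨(hmemX' q').1 hq'X, by rw [hMdist]; exact hd⟩
    rw [this, card_image_of_injective _ hMinj]
  set W := X.filter (fun z => -R₀ - 2 ≤ z 2 ∧ z 2 ≤ h + R₀ + 2) with hW
  set W₁ := X.filter (fun z => (-R₀ - 2 ≤ z 2 ∧ z 2 ≤ h + R₀ + 2) ∧ z ∈ Λ₁) with hW₁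
  set W₂ := X.filter (fun z => (-R₀ - 2 ≤ z 2 ∧ z 2 ≤ h + R₀ + 2) ∧ z ∈ Λ₂) with hW₂
  have hpull : ∑ z ∈ X'.filter (fun z => (-R₀ - 2 ≤ z 2 ∧ z 2 ≤ h + R₀ + 2) ∧
        z ∈ (fun q => G' q + M t₂) '' fccStacking 1 (Real.sqrt (2 / 3))),
        ((12 : ℝ) - ((X'.filter fun q => dist z q = 1).card : ℝ)) =
      ∑ z ∈ W₂, ((12 : ℝ) - ((X.filter fun q => dist z q = 1).card : ℝ)) := by
    have hset : X'.filter (fun z => (-R₀ - 2 ≤ z 2 ∧ z 2 ≤ h + R₀ + 2) ∧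
        z ∈ (fun q => G' q + M t₂) '' fccStacking 1 (Real.sqrt (2 / 3))) = W₂.image M := by
      ext z
      constructor
      · intro hz'
        obtain ⟨hz, hwin, hlam⟩ := mem_filter.1 hz'
        refine Finset.mem_image.2 ⟨M z, mem_filter.2 ⟨(hmemX' z).1 hz, ?_, (hlat t₂ z).2 hlam⟩, hMM z⟩
        rw [hM2]; constructor <;> linarith [hwin.1, hwin.2]
      · intro hz'
        obtain ⟨y, hy, hyz⟩ := Finset.mem_image.1 hz'
        subst hyz
        obtain ⟨hyX, hwin, hlam⟩ := mem_filter.1 hy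
        refine mem_filter.2 ⟨(hmemX' _).2 (by rw [hMM]; exact hyX), ?_, (hlat t₂ (M y)).1 (by rw [hMM]; exact hlam)⟩
        rw [hM2]; constructor <;> linarith [hwin.1, hwin.2]
    rw [hset, sum_image fun a _ b _ hab => hMinj hab]
    refine sum_congr rfl fun z _ => ?_
    rw [hdeg, hMM]
  rw [hpull] at h₂
  -- (3) add: `W₁`, `W₂` are disjoint parts of `W`, all terms nonnegative
  have hdisj : Disjoint W₁ W₂ := by
    rw [Finset.disjoint_left]
    intro z hz₁ hz₂
    exact movedFcc_ne_of_coset A t₁ t₂ hA (mem_filter.1 hz₁).2.2 (mem_filter.1 hz₂).2.2 rfl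
  have hsub : W₁ ∪ W₂ ⊆ W := by
    intro z hz
    rcases mem_union.1 hz with h' | h'
    · exact mem_filter.2 ⟨(mem_filter.1 h').1, (mem_filter.1 h').2.1⟩
    · exact mem_filter.2 ⟨(mem_filter.1 h').1, (mem_filter.1 h').2.1⟩
  have hnonneg : ∀ z ∈ W, (0 : ℝ) ≤ 12 - ((X.filter fun q => dist z q = 1).card : ℝ) := by
    intro z _
    have h12 : ((X.filter fun q => dist z q = 1).card : ℝ) ≤ 12 := by
      exact_mod_cast card_filter_dist_eq_one_le_twelve X hX z
    linarith
  have hsplit : ∑ z ∈ W₁, ((12 : ℝ) - ((X.filter fun q => dist z q = 1).card : ℝ)) +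
      ∑ z ∈ W₂, ((12 : ℝ) - ((X.filter fun q => dist z q = 1).card : ℝ)) ≤
      ∑ z ∈ W, ((12 : ℝ) - ((X.filter fun q => dist z q = 1).card : ℝ)) := by
    rw [← sum_union hdisj]
    exact sum_le_sum_of_subset_of_nonneg hsub fun z hz _ => hnonneg z hz
  have h₁' : 2 * (Real.sqrt 2 / 4 * ∑ᶠ w ∈ {w ∈ fccStacking 1 (Real.sqrt (2 / 3)) | ‖w‖ = 1},
        |⟪w, A.symm (EuclideanSpace.single (2 : Fin 3) (1 : ℝ))⟫_ℝ|) * Real.pi * ρ ^ 2 -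
        12 * (12 * Real.sqrt 2 * Real.pi + 36 * R₀ + 144) * ρ ≤
      ∑ z ∈ W₁, ((12 : ℝ) - ((X.filter fun q => dist z q = 1).card : ℝ)) := h₁
  have h₂' : 2 * (Real.sqrt 2 / 4 * ∑ᶠ w ∈ {w ∈ fccStacking 1 (Real.sqrt (2 / 3)) | ‖w‖ = 1},
        |⟪w, A.symm (EuclideanSpace.single (2 : Fin 3) (1 : ℝ))⟫_ℝ|) * Real.pi * ρ ^ 2 -
        12 * (12 * Real.sqrt 2 * Real.pi + 36 * R₀ + 144) * ρ ≤
      ∑ z ∈ W₂, ((12 : ℝ) - ((X.filter fun q => dist z q = 1).card : ℝ)) := h₂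
  linarith only [h₁', h₂', hsplit]

end Summit.Ventures.Crystal3D.Theorems

end
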